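import Literature.AlgebraicGeometry.Motives.HodgeGroupOfOrientationMinusIdentityCyclicSextic
import Mathlib.NumberTheory.Cyclotomic.Gal
import HarnessLib

/-!
# The cyclotomic field `ℚ(ζ₇)`: an UNCONDITIONAL weight-`2` SCMpHS with Hodge numbers `(2,2,2)`, no rational `(1,1)`-classes,
# `M_φ(ℝ) ≠ 1` and `−id ∉ M_φ` (the cyclic sextic witness of `HodgeGroupOfOrientationMinusIdentityCyclicSextic`, instantiated)

[topic AlgebraicGeometry/Motives]

Layer `Literature/AlgebraicGeometry/Motives`, lane `lit-hodgefound` (Track 2 foundations library; seat `lit-hodgefound-p02`, gen 29, row g29-#5).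
THEOREMS ONLY (no definition, no named fact, no instance; D-0026 net debt `0`).  g29-#3 `Motives/HodgeGroupOfOrientationMinusIdentityCyclicSextic` proved, for
ANY Galois CM field `L` with an isomorphism `e : Gal(L/ℚ) ≃* ℤ/6`, that the `2`-orientation with degrees `(2,2,1,0,0,1)` along `ι ∘ e⁻¹(i)` is a polarizable CM Hodge
structure of weight `2` with `h = (2,2,2)`, `Hdg¹ = 0`, `M_φ(ℝ) ≠ 1` and `−id ∉ M_φ` — in hypothesis form («`(L, ι, e)` is NOT constructed»).  This file discharges the
hypothesis on GGK's own family of example fields, the cyclotomic fields ((V.A.4): «Fixing `θ₁ : ζ_m ↦ e^{2πi/m}` when `F = ℚ(ζ_m)` … `θ_i = θ₁ ∘ σ_i` where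
`σ_i(ζ_m) := ζ_m^i`»), for `m = 7`: `Gal(ℚ(ζ₇)/ℚ) ≅ (ℤ/7)^×` (Mathlib's `IsCyclotomicExtension.autEquivPow`) is cyclic of order `φ(7) = 6`, hence `≃* ℤ/6`
(`mulEquivOfCyclicCardEq`; WHICH isomorphism is irrelevant — g29-#3 `map_conjGal_eq`: complex conjugation is the unique involution), and `ℚ(ζ₇)` is a Galois CM field
(Mathlib's `IsCyclotomicExtension.isGalois`, `IsCyclotomicExtension.Rat.isCMField`).

WHAT IS PROVED.  `nonempty_mulEquiv_gal_cyclotomicField_seven` (`Gal(ℚ(ζ₇)/ℚ) ≃* ℤ/6`), `finrank_cyclotomicField_seven` (`[ℚ(ζ₇):ℚ] = 6`), and the unconditional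
**`exists_orientation_cyclotomicField_seven`**: for every embedding `ι : ℚ(ζ₇) → ℂ` there is a `2`-orientation `Π` of `ℚ(ζ₇)` whose SCMpHS `V = V²_{(ℚ(ζ₇),Π)}`
(a `ℚ`-Hodge structure of weight `2` on the `6`-dimensional `ℚ`-space `ℚ(ζ₇)`) is polarizable, has `h^{2,0} = h^{1,1} = h^{0,2} = 2`, `Hdg¹(V) = V_ℚ ∩ V^{1,1} = 0`, a
NON-TRIVIAL Hodge group `M_φ(ℝ) ≠ 1`, and `−id ∉ M_φ` on `ℂ`-, `ℝ`- and `ℚ`-points; consequently `Ker ν ≠ M_φ` for EVERY polarization `ψ` (`ν(−id) = 1`), `M_φ̃(ℝ)` has no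
positive polar factorisation `ℝ^×_{>0} · M_φ(ℝ)`, `M_φ̃(ℝ) ≠ ⟨⋃_{Π′} φ̃_{Π′}(S(ℝ))⟩`, and `𝔾_m ∩ M_φ = 1`.  In particular the hypothesis «`−id ∈ M_φ`» of g29-#1 / g29-#2
(automatic in odd weight) is a genuine restriction in even weight, already for polarizable CM Hodge structures without rational `(1,1)`-classes.

HONEST SCOPE.  (1) `IsGalois ℚ ℚ(ζ₇)` / `IsCMField ℚ(ζ₇)` are Mathlib theorems used through private lemmas and `haveI` (no `instance` declared), exactly as in g26-#9
`Motives/CyclotomicFieldThirteenOrientation`.  (2) The orientation is only shown to EXIST with the listed properties (it is `ofGaloisDeg` of the table transported along an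
unspecified `e`); in GGK's labelling `θ_a : ζ₇ ↦ e^{2πia/7}` one such `Π` is `Π^{2,0} = {θ₁, θ₃}`, `Π^{1,1} = {θ₂, θ₅}`, `Π^{0,2} = {θ₆, θ₄}` (generator `3` of `(ℤ/7)^×`),
not asserted in Lean.  (3) No geometric realisation (abelian variety / motive) is claimed.

## References
* [GreenGriffithsKerr2012] M. Green, P. Griffiths, M. Kerr, *Mumford–Tate Groups and Domains* (2012) — (V.A.4) p. 156 (`ℚ(ζ_m)`, `σ_i(ζ_m) = ζ_m^i`); §V Warning p. 154;
  §I.B p. 35.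
* [Moonen2004MT] B. Moonen, *An introduction to Mumford–Tate groups* (2004) — (5.8).
* [CarlsonMullerStachPeters2017] J. Carlson, S. Müller-Stach, C. Peters, *Period Mappings and Period Domains*, 2nd ed. (2017) — §15.2 Examples 15.2.4.
* [Deligne1982HodgeCycles] P. Deligne, *Hodge cycles on abelian varieties*, in LNM 900 (1982) — I Example 3.7 (d).

## Provenance
Lane `lit-hodgefound` (Hodge path, Track 2), prover seat `lit-hodgefound-p02` (generation 29), self-proposed row g29-#5 (instantiating g29-#3).
-/

noncomputable section

open scoped TensorProduct Classical
open Module NumberField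

namespace Literature.AlgebraicGeometry.Motives

namespace HodgeStructure

open Orientation Literature.NumberTheory.ComplexMultiplication

/-! ### §1 `ℚ(ζ₇)`: Galois, CM, `Gal ≃* ℤ/6` -/

/-- `ℚ(ζ₇)` is the `7`-th cyclotomic extension of `ℚ` (named instance term). [folklore] -/
private theorem isCyclotomicExtension_cf7 : IsCyclotomicExtension {7} ℚ (CyclotomicField 7 ℚ) :=
  CyclotomicField.isCyclotomicExtension 7 ℚ

/-- `Φ₇` is irreducible over `ℚ`. [folklore] -/
private theorem irreducible_cyclotomic_cf7 : Irreducible (Polynomial.cyclotomic 7 ℚ) :=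
  Polynomial.cyclotomic.irreducible_rat (by norm_num)

/-- `ℚ(ζ₇)/ℚ` is Galois. [folklore] -/
private theorem isGalois_cf7 : IsGalois ℚ (CyclotomicField 7 ℚ) :=
  haveI := isCyclotomicExtension_cf7
  IsCyclotomicExtension.isGalois {7} ℚ (CyclotomicField 7 ℚ)

/-- `ℚ(ζ₇)` is a CM field. [folklore] -/
private theorem isCMField_cf7 : IsCMField (CyclotomicField 7 ℚ) :=
  @IsCyclotomicExtension.Rat.isCMField (CyclotomicField 7 ℚ) _ _ {7} ⟨7, Set.mem_singleton 7, by norm_num⟩ isCyclotomicExtension_cf7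

/-- **`Gal(ℚ(ζ₇)/ℚ) ≃* ℤ/6`**: `Gal(ℚ(ζ₇)/ℚ) = {σ_i : ζ₇ ↦ ζ₇^i} ≅ (ℤ/7)^×` is cyclic of order `φ(7) = 6`. [cite: GreenGriffithsKerr2012, (V.A.4) p. 156] -/
theorem nonempty_mulEquiv_gal_cyclotomicField_seven :
    Nonempty (((CyclotomicField 7 ℚ) ≃ₐ[ℚ] (CyclotomicField 7 ℚ)) ≃* Multiplicative (ZMod 6)) := by
  haveI := isCyclotomicExtension_cf7
  haveI : Fact (Nat.Prime 7) := ⟨by norm_num⟩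
  let e₁ : ((CyclotomicField 7 ℚ) ≃ₐ[ℚ] (CyclotomicField 7 ℚ)) ≃* (ZMod 7)ˣ :=
    IsCyclotomicExtension.autEquivPow (CyclotomicField 7 ℚ) irreducible_cyclotomic_cf7
  haveI : IsCyclic ((CyclotomicField 7 ℚ) ≃ₐ[ℚ] (CyclotomicField 7 ℚ)) :=
    isCyclic_of_surjective (e₁.symm : (ZMod 7)ˣ →* _) e₁.symm.surjective
  have hcard : Nat.card ((CyclotomicField 7 ℚ) ≃ₐ[ℚ] (CyclotomicField 7 ℚ)) = Nat.card (Multiplicative (ZMod 6)) := by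
    rw [Nat.card_congr e₁.toEquiv, Nat.card_eq_fintype_card, ZMod.card_units_eq_totient]
    simp [Nat.card_eq_fintype_card]
    decide
  exact ⟨mulEquivOfCyclicCardEq hcard⟩

/-- `[ℚ(ζ₇):ℚ] = 6` (the summit tree's `Summit.HodgeConjecture.CorCM.Domination.finrank_cyclotomic7` states the same; it is not importable from `Literature/`).
[cite: GreenGriffithsKerr2012, (V.A.4) p. 156] -/
theorem finrank_cyclotomicField_seven : Module.finrank ℚ (CyclotomicField 7 ℚ) = 6 := by
  obtain ⟨e⟩ := nonempty_mulEquiv_gal_cyclotomicField_seven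
  haveI := isGalois_cf7
  exact finrank_eq_six e

/-! ### §2 The unconditional witness -/

/-- **An unconditional even-weight witness on `ℚ(ζ₇)`.**  For every `ι : ℚ(ζ₇) → ℂ` there is a `2`-orientation `Π` of `ℚ(ζ₇)` such that the SCMpHS
`V = V²_{(ℚ(ζ₇),Π)}` (weight `2`, `dim_ℚ V = 6`) is polarizable with `h^{2,0} = h^{1,1} = h^{0,2} = 2`, has NO non-zero rational `(1,1)`-class, a non-trivial Hodge
group `M_φ(ℝ) ≠ 1`, and `−id ∉ M_φ` (on `ℂ`-, `ℝ`-, `ℚ`-points); hence `Ker ν ≠ M_φ` for every polarization, no positive polar factorisation of `M_φ̃(ℝ)`,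
`M_φ̃(ℝ) ≠ ⟨⋃_{Π′ ∈ Aut(ℂ)·Π} φ̃_{Π′}(S(ℝ))⟩`, and `𝔾_m ∩ M_φ = 1`. [cite: GreenGriffithsKerr2012, (V.A.4) p. 156 and §V Warning p. 154] [cite: Moonen2004MT, (5.8)]
[cite: CarlsonMullerStachPeters2017, §15.2 Examples 15.2.4] [cite: Deligne1982HodgeCycles, I Example 3.7 (d)] -/
theorem exists_orientation_cyclotomicField_seven [HodgeTensorFacts.{0, 0}] (ι : CyclotomicField 7 ℚ →+* ℂ) :
    ∃ Λ : Orientation (CyclotomicField 7 ℚ) 2,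
      (ofOrientation Λ).IsPolarizable ∧
      (ofOrientation Λ).hodgeNumber 2 0 = 2 ∧ (ofOrientation Λ).hodgeNumber 1 1 = 2 ∧ (ofOrientation Λ).hodgeNumber 0 2 = 2 ∧
      (ofOrientation Λ).hodgeClasses 1 = ⊥ ∧
      (ofOrientation Λ).hodgeGroupBaseChange ℝ ≠ ⊥ ∧
      (LinearEquiv.smulOfUnit (-1 : ℂˣ) : (ℂ ⊗[ℚ] CyclotomicField 7 ℚ) ≃ₗ[ℂ] (ℂ ⊗[ℚ] CyclotomicField 7 ℚ)) ∉
          (ofOrientation Λ).hodgeGroupBaseChange ℂ ∧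
      (LinearEquiv.smulOfUnit (-1 : ℝˣ) : (ℝ ⊗[ℚ] CyclotomicField 7 ℚ) ≃ₗ[ℝ] (ℝ ⊗[ℚ] CyclotomicField 7 ℚ)) ∉
          (ofOrientation Λ).hodgeGroupBaseChange ℝ ∧
      (LinearEquiv.smulOfUnit (-1 : ℚˣ) : CyclotomicField 7 ℚ ≃ₗ[ℚ] CyclotomicField 7 ℚ) ∉ (ofOrientation Λ).hodgeGroup ∧
      (∀ ψ : (ofOrientation Λ).Polarization,
        ∃ (γ : (ℂ ⊗[ℚ] CyclotomicField 7 ℚ) ≃ₗ[ℂ] (ℂ ⊗[ℚ] CyclotomicField 7 ℚ)) (hγ : γ ∈ (ofOrientation Λ).mumfordTateGroupBaseChange ℂ),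
          ψ.multiplierChar ℂ ⟨γ, hγ⟩ = 1 ∧ γ ∉ (ofOrientation Λ).hodgeGroupBaseChange ℂ) ∧
      (¬∀ γ : (ℝ ⊗[ℚ] CyclotomicField 7 ℚ) ≃ₗ[ℝ] (ℝ ⊗[ℚ] CyclotomicField 7 ℚ), γ ∈ (ofOrientation Λ).mumfordTateGroupBaseChange ℝ →
        ∃ (t : ℝˣ) (η : (ℝ ⊗[ℚ] CyclotomicField 7 ℚ) ≃ₗ[ℝ] (ℝ ⊗[ℚ] CyclotomicField 7 ℚ)),
          0 < (t : ℝ) ∧ η ∈ (ofOrientation Λ).hodgeGroupBaseChange ℝ ∧ γ = LinearEquiv.smulOfUnit t * η) ∧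
      (ofOrientation Λ).mumfordTateGroupBaseChange ℝ ≠
        Subgroup.closure (⋃ Λ' ∈ {Λ' : Orientation (CyclotomicField 7 ℚ) 2 | ∃ τ : ℂ ≃+* ℂ, ∀ θ, Λ'.deg θ = Λ.deg (τ • θ)},
          Set.range ⇑(ofOrientation Λ').realHodgeTorus) ∧
      (∀ s : ℂˣ, (LinearEquiv.smulOfUnit s : (ℂ ⊗[ℚ] CyclotomicField 7 ℚ) ≃ₗ[ℂ] (ℂ ⊗[ℚ] CyclotomicField 7 ℚ)) ∈
          (ofOrientation Λ).hodgeGroupBaseChange ℂ ↔ s = 1) := by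
  obtain ⟨e⟩ := nonempty_mulEquiv_gal_cyclotomicField_seven
  haveI := isGalois_cf7
  haveI := isCMField_cf7
  obtain ⟨Λ, hΛ⟩ := exists_orientation_deg_comp_eq ι e
  have h20 := hodgeNumber_two_zero ι e Λ hΛ
  have h11 := hodgeNumber_one_one ι e Λ hΛ
  have h02 := hodgeNumber_zero_two ι e Λ hΛ
  norm_num at h20 h11 h02
  exact ⟨Λ, isPolarizable_ofOrientation Λ, h20, h11, h02, hodgeClasses_one_eq_bot ι e Λ hΛ, hodgeGroupBaseChange_real_ne_bot ι e Λ hΛ,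
    smulOfUnit_neg_one_not_mem_hodgeGroupBaseChange_complex ι e Λ hΛ, smulOfUnit_neg_one_not_mem_hodgeGroupBaseChange_real ι e Λ hΛ,
    smulOfUnit_neg_one_not_mem_hodgeGroup ι e Λ hΛ, exists_mem_mumfordTateGroupBaseChange_multiplierChar_eq_one_not_mem ι e Λ hΛ,
    not_forall_exists_pos_smulOfUnit_mul_eq ι e Λ hΛ, mumfordTateGroupBaseChange_real_ne_closure_iUnion_range_realHodgeTorus ι e Λ hΛ,
    forall_smulOfUnit_mem_hodgeGroupBaseChange_complex_iff_eq_one ι e Λ hΛ⟩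

end HodgeStructure

end Literature.AlgebraicGeometry.Motives

end
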